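import Summits.QuantumFields.YangMills.Theorems.IR.AfPincerUcPortGoodFS
import Summits.QuantumFields.YangMills.Theorems.IR.AfPincerUcPortPeierls
import Literature.Probability.LatticeModels.CoarseCellMixingDefectsUniform

/-!
# The port of `stub_typCriterionUc` (line `af-pincer-Uc`, crux `IR`): the engine instance — a per-box uniform
# two-exterior influence bound for the `ℤ⁴` Wilson kernels from clauses (i) [every centre] and (ii) [UKP]

Helper theorem for item `stmt-QuantumFields-19354` (crux `IR`; architecture δ' of `MEMO-g6-port-map.md`, seat ym-cruxidea-19354-1
g6, §3 table rows «`uniform_influence_markov_defects` applied with `Δg :=` rind labels» and «identification» P6a; this is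
the memo's `EnginePortT` with its hypotheses SPELLED OUT, so that the module stays outside every route-file cone).

`box_uniform_influence n ε`: for admissible `(n, ε)` (`0 ≤ ε`, `ε · shellCount 4 n ≤ 3/4`) there are `δ₀, θ ∈ (0,1)`,
`C₁ ≥ 0` — the constants `q₀, e^{-κₑ}, C` of the tree engine `Literature.Probability.LatticeModels.uniform_influence_markov_defects`
at `(4, n)`, so depending on `n` only — such that: for every compact metrisable group `G`, continuous `ρ`, coupling `β`,
frame `w` with steps `≥ 1`, family `Typ` (measurable, cell-local) with clause (i) at EVERY centre (through the landed
`FixedMesh.ClauseI`) and clause (ii) in UKP form at level `δ ∈ [0, δ₀]`, and a padding `pad` typical on every cell, the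
Wilson kernels of the INNER cells of any box of `m ≥ 3` cells per side satisfy, for every set `Δf` of inner cells at
cell-distance `≥ D` from the rind, every `[0,1]`-valued measurable cylinder observable `f` of the cells `Δf` and EVERY two
`ℤ⁴` exteriors `η, η'`:
`|γ_{inner} f(η) − γ_{inner} f(η')| ≤ C₁ · e^{#Δf} · #rind · θ^D`.

Proof = instantiate the engine on the box specification `boxSpec ρ β w x₀ m pad` (`AfPincerUcPortBoxDefs`), whose four
hypotheses are `isSpecification_boxSpec` (P1), `hasBlockLeak_boxSpec` (P2), `isGoodFS_boxSpec` (P3),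
`uniformKernelPeierls_boxSpec` (P4), with sources `Δg :=` the rind labels; then identify the box kernel of the inner links
in the exterior `boxRestrict η` with the `ℤ⁴` kernel of the inner cells in the exterior `η` (the kernel reads only box
links: the interaction has range one and inner cells are one cell away from the complement of the box).

HONEST FRAMING: bookkeeping for one stub of one open gap-crux of a CONDITIONAL chain; no claim about the crux or the gap.
-/

set_option autoImplicit false

noncomputable section

open MeasureTheory
open Literature.MathematicalPhysics.QuantumLattice
open Literature.Probability.LatticeModels
open Summit.QuantumFields.YangMills.Cruxes.IR.Tempered (cellEdges regionEdges)
open Summit.QuantumFields.YangMills.Cruxes.IR.CellTempered.Engine (shiftFrame frameCell frameCell_eq_iff frame_hC1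
  mem_cellEdges_frameCell)
open Summit.QuantumFields.YangMills.Cruxes.IR.FixedMesh (ClauseI)

namespace Summit.QuantumFields.YangMills.Cruxes.IR.AfPincerUc.Port

section Identification

variable {G : Type} [Group G] [TopologicalSpace G] [IsTopologicalGroup G] [CompactSpace G]
  [MeasurableSpace G] [BorelSpace G]
variable {N : ℕ} (ρ : G →* Matrix (Fin N) (Fin N) ℂ) (hρ : Continuous ρ) (β : ℝ)
  {w : Fin 4 → ℤ → ℤ} (hw : ∀ i j, w i j + 1 ≤ w i (j + 1)) (x₀ : Fin 4 → ℤ) (m n : ℕ) (pad : LGConfig 4 G)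

/-- A cell at index distance `≤ 1` from an inner cell is a box cell. -/
theorem mem_boxCells_of_near_inner {y z : Fin 4 → ℤ} (hy : y ∈ innerCells x₀ m) (h : ∀ k, |z k - y k| ≤ 1) :
    z ∈ boxCells x₀ m := by
  rw [mem_innerCells_iff] at hy
  rw [mem_boxCells_iff]
  intro k
  have h1 := abs_le.1 (h k)
  have h2 := hy k
  constructor <;> omega

include hw in
omit [Group G] [TopologicalSpace G] [IsTopologicalGroup G] [CompactSpace G] [MeasurableSpace G] [BorelSpace G] in
/-- The edges of the plaquettes touching the inner links are box links (the Wilson interaction has range one). -/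
theorem collar_inner_subset_box {e : ZdEdge 4}
    (he : e ∈ (plaquettesTouching (regionEdges w (innerCells x₀ m))).biUnion plaquetteEdges) :
    e ∈ boxEdges w x₀ m := by
  obtain ⟨e', he', hnear⟩ := exists_near_of_mem_collar he
  rw [mem_regionEdges_iff hw] at he'
  rw [mem_boxEdges_iff hw]
  exact mem_boxCells_of_near_inner x₀ m he' fun k => frame_hC1 hw e e' hnear k

include hw in
omit [Group G] [TopologicalSpace G] [IsTopologicalGroup G] [CompactSpace G] [MeasurableSpace G] [BorelSpace G] in
/-- The inner links, as the engine's volume «links whose label is not a rind label», mapped to `ℤ⁴`. -/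
theorem map_filter_not_rind :
    (Finset.univ.filter fun v : BoxLink w x₀ m =>
        boxCell w x₀ m n v ∉ (rindCells x₀ m).image (boxLabel x₀ m n)).map
      (Function.Embedding.subtype fun e => e ∈ boxEdges w x₀ m) = regionEdges w (innerCells x₀ m) := by
  classical
  ext e
  rw [mem_regionEdges_iff hw, Finset.mem_map]
  constructor
  · rintro ⟨v, hv, rfl⟩
    have hvB := frameCell_mem_boxCells hw v
    have hv' := (Finset.mem_filter.1 hv).2
    rcases mem_innerCells_or_mem_rindCells hvB with h | h
    · exact h
    · exact absurd (Finset.mem_image.2 ⟨_, h, rfl⟩) hv'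
  · intro he
    have heB : e ∈ boxEdges w x₀ m := (mem_boxEdges_iff hw e).2 (innerCells_subset_boxCells x₀ m he)
    refine ⟨⟨e, heB⟩, Finset.mem_filter.2 ⟨Finset.mem_univ _, fun h => ?_⟩, rfl⟩
    obtain ⟨y, hy, hye⟩ := Finset.mem_image.1 h
    have hyB := rindCells_subset_boxCells x₀ m hy
    have : frameCell w e = y := (boxCell_eq_boxLabel_iff hw ⟨e, heB⟩ hyB).1 hye.symm
    exact (Finset.mem_sdiff.1 hy).2 (this ▸ he)

include hρ hw in
/-- **Kernel identification (P6a).**  The box kernel of the inner links in the exterior `boxRestrict η`, tested on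
`f ∘ boxExt`, is the `ℤ⁴` kernel of the inner cells in the exterior `η` tested on `f`, for every cylinder observable
`f` of box links. -/
theorem integral_boxSpec_inner_eq [SecondCountableTopology G] (A : Finset (BoxLink w x₀ m))
    (hA : A.map (Function.Embedding.subtype fun e => e ∈ boxEdges w x₀ m) = regionEdges w (innerCells x₀ m))
    {f : LGConfig 4 G → ℝ} {S₀ : Finset (ZdEdge 4)} (hfS : IsCylinder f S₀) (hS₀ : S₀ ⊆ boxEdges w x₀ m)
    (hfm : Measurable f) (η : LGConfig 4 G) :
    ∫ ζ, f (boxExt w x₀ m pad ζ) ∂(boxSpec ρ β w x₀ m pad A (boxRestrict w x₀ m η)) =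
      ∫ U, f U ∂(ymSpecification ρ β (regionEdges w (innerCells x₀ m)) η) := by
  have hfm' : Measurable fun ζ : BoxLink w x₀ m → G => f (boxExt w x₀ m pad ζ) := hfm.comp (measurable_boxExt pad)
  rw [integral_boxSpec ρ β w x₀ m pad A _ hfm', hA]
  -- `f ∘ boxExt ∘ boxRestrict = f` (cylinder on box links)
  have hcomp : ∀ U : LGConfig 4 G, f (boxExt w x₀ m pad (boxRestrict w x₀ m U)) = f U := by
    intro U
    refine hfS fun e he => ?_
    rw [boxExt_apply_mem pad _ (hS₀ (Finset.mem_coe.1 he))]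
    rfl
  simp only [hcomp]
  -- the kernel reads the exterior only on box links, where `boxExt (boxRestrict η)` and `η` agree
  refine dependsOn_integral_ymSpecification ρ hρ β _ hfm hfS fun e he => ?_
  have heB : e ∈ boxEdges w x₀ m := by
    rcases Finset.mem_union.1 (Finset.mem_coe.1 he) with he | he
    · exact hS₀ he
    · exact collar_inner_subset_box hw x₀ m he
  rw [boxExt_apply_mem pad _ heB]
  rfl

end Identification

/-! ## The engine instance -/

section Engine

/-- `e^{-κ D} = (e^{-κ})^D`. -/
private theorem exp_neg_mul_nat (κ : ℝ) (D : ℕ) : Real.exp (-(κ * D)) = Real.exp (-κ) ^ D := by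
  rw [← Real.exp_nat_mul]; ring_nf

/-- **The engine instance (architecture δ'): per-box uniform two-exterior influence bound for the `ℤ⁴` Wilson kernels
from clause (i) at every centre and clause (ii) in UKP form.**  See the module docstring. -/
theorem box_uniform_influence (n : ℕ) (ε : ℝ) (hε : 0 ≤ ε) (hεs : ε * (shellCount 4 n : ℝ) ≤ 3 / 4) :
    ∃ δ₀ θ C₁ : ℝ, 0 < δ₀ ∧ 0 < θ ∧ θ < 1 ∧ 0 ≤ C₁ ∧
    ∀ {G : Type} [Group G] [TopologicalSpace G] [IsTopologicalGroup G] [CompactSpace G] [MeasurableSpace G]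
      [BorelSpace G] [T2Space G] [SecondCountableTopology G] {N : ℕ} (ρ : G →* Matrix (Fin N) (Fin N) ℂ),
      Continuous ρ → ∀ (β : ℝ) (w : Fin 4 → ℤ → ℤ), (∀ i j, w i j + 1 ≤ w i (j + 1)) →
      ∀ (Typ : (Fin 4 → ℤ) → Set (LGConfig 4 G)) (pad : LGConfig 4 G) (δ : ℝ),
        (∀ c, MeasurableSet (Typ c)) → (∀ c, DependsOn (fun σ : LGConfig 4 G => σ ∈ Typ c) ↑(cellEdges w c)) →
        (∀ c₀ : Fin 4 → ℤ, ClauseI ρ β (shiftFrame w c₀) n ε (fun c => Typ (c + c₀))) →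
        (∀ F F' : Finset (Fin 4 → ℤ), F ⊆ F' → F.Nonempty → ∀ ζ : LGConfig 4 G,
          (∀ c ∈ F, ∀ c' : Fin 4 → ℤ, (∀ i, |c' i - c i| ≤ 1) → c' ∈ F' ∨ ζ ∈ Typ c') →
            (ymSpecification ρ β (regionEdges w F') ζ) {σ : LGConfig 4 G | ∀ c ∈ F, σ ∉ Typ c} ≤
              ENNReal.ofReal (δ ^ F.card)) →
        (∀ c, pad ∈ Typ c) → 0 ≤ δ → δ ≤ δ₀ →
        ∀ (x₀ : Fin 4 → ℤ) (m : ℕ), 3 ≤ m →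
          ∀ Δf : Finset (Fin 4 → ℤ), Δf ⊆ innerCells x₀ m →
            ∀ D : ℕ, (∀ x ∈ Δf, ∀ y ∈ rindCells x₀ m, D ≤ cellDist x y) →
              ∀ f : LGConfig 4 G → ℝ, IsCylinder f (regionEdges w Δf) → Measurable f →
                (∀ U, 0 ≤ f U ∧ f U ≤ 1) →
                ∀ η η' : LGConfig 4 G,
                  |(∫ U, f U ∂(ymSpecification ρ β (regionEdges w (innerCells x₀ m)) η)) -
                      ∫ U, f U ∂(ymSpecification ρ β (regionEdges w (innerCells x₀ m)) η')| ≤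
                    C₁ * Real.exp (Δf.card) * (rindCells x₀ m).card * θ ^ D := by
  obtain ⟨q₀, κₑ, C, hq₀, hκₑ, hC, hengine⟩ := uniform_influence_markov_defects.{0, 0} 4 n
  refine ⟨q₀, Real.exp (-κₑ), C, hq₀, Real.exp_pos _, Real.exp_lt_one_iff.2 (neg_lt_zero.2 hκₑ), hC, ?_⟩
  intro G _ _ _ _ _ _ _ _ N ρ hρ β w hw Typ pad δ hTm hTd hI hII hpad hδ hδq x₀ m hm Δf hΔf D hD f hfS hfm hf01 η η'
  classical
  -- the instance
  have hγ := isSpecification_boxSpec ρ hρ β x₀ m pad (w := w)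
  have hFS := isGoodFS_boxSpec ρ hρ β hw x₀ m n pad hTm hTd hI hpad hε
  have hBL := hasBlockLeak_boxSpec ρ hρ β hw x₀ m n pad (0 : ℝ)
  have hUKP := uniformKernelPeierls_boxSpec ρ hρ β hw x₀ m n pad hTm hTd hII hpad
  have hμ : ∀ i : Fin 4, 4 * n + 3 ≤ boxMod m n i + 1 := fun i => by simp only [boxMod]; omega
  -- the observable, the cells, the sources
  set f' : (BoxLink w x₀ m → G) → ℝ := fun ζ => f (boxExt w x₀ m pad ζ) with hf'
  set Δf' : Finset (CoarseIdx (boxMod m n)) := Δf.image (boxLabel x₀ m n) with hΔf'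
  set Δg : Finset (CoarseIdx (boxMod m n)) := (rindCells x₀ m).image (boxLabel x₀ m n) with hΔg
  have hΔfB : ∀ x ∈ Δf, x ∈ boxCells x₀ m := fun x hx => innerCells_subset_boxCells x₀ m (hΔf hx)
  have hx₀rind : x₀ ∈ rindCells x₀ m := by
    refine Finset.mem_sdiff.2 ⟨(mem_boxCells_iff x₀ m x₀).2 fun i => ⟨le_rfl, by omega⟩, fun h => ?_⟩
    have := ((mem_innerCells_iff x₀ m x₀).1 h 0).1
    omega
  have hΔgne : Δg.Nonempty := ⟨_, Finset.mem_image.2 ⟨x₀, hx₀rind, rfl⟩⟩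
  have hf'm : Measurable f' := hfm.comp (measurable_boxExt pad)
  have hf'01 : ∀ ζ, 0 ≤ f' ζ ∧ f' ζ ≤ 1 := fun ζ => hf01 _
  have hf'dep : DependsOn f' {v | boxCell w x₀ m n v ∈ Δf'} := by
    intro ζ ζ' h
    refine hfS fun e he => ?_
    have hcell : frameCell w e ∈ Δf := (mem_regionEdges_iff hw Δf e).1 (Finset.mem_coe.1 he)
    have heB : e ∈ boxEdges w x₀ m := (mem_boxEdges_iff hw e).2 (hΔfB _ hcell)
    rw [boxExt_apply_mem pad ζ heB, boxExt_apply_mem pad ζ' heB]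
    exact h ⟨e, heB⟩ (Finset.mem_image.2 ⟨_, hcell, rfl⟩)
  have hfar : ∀ x ∈ Δf', ∀ y ∈ Δg, D ≤ cdist x y := by
    intro x hx y hy
    obtain ⟨x₁, hx₁, rfl⟩ := Finset.mem_image.1 hx
    obtain ⟨y₁, hy₁, rfl⟩ := Finset.mem_image.1 hy
    rw [cdist_boxLabel (hΔfB _ hx₁) (rindCells_subset_boxCells x₀ m hy₁)]
    exact hD x₁ hx₁ y₁ hy₁
  -- the engine
  have key := hengine (boxCell w x₀ m n) (boxSpec ρ β w x₀ m pad) (boxGood w x₀ m n pad Typ) ε δ 0 hμ hγ hε hεs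
    hFS hBL hδ hδq hUKP f' Δf' Δg D hΔgne hf'm hf'01 hf'dep hfar (boxRestrict w x₀ m η) (boxRestrict w x₀ m η')
  -- identification of the two kernels
  have hA := map_filter_not_rind hw x₀ m n
  have hS₀ : regionEdges w Δf ⊆ boxEdges w x₀ m := by
    intro e he
    exact (mem_boxEdges_iff hw e).2 (hΔfB _ ((mem_regionEdges_iff hw Δf e).1 he))
  rw [integral_boxSpec_inner_eq ρ hρ β hw x₀ m pad _ hA hfS hS₀ hfm η,
    integral_boxSpec_inner_eq ρ hρ β hw x₀ m pad _ hA hfS hS₀ hfm η'] at key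
  refine key.trans ?_
  -- constants
  rw [exp_neg_mul_nat]
  have hθD : 0 ≤ Real.exp (-κₑ) ^ D := pow_nonneg (Real.exp_pos _).le _
  have h1 : Real.exp (Δf'.card : ℝ) ≤ Real.exp (Δf.card : ℝ) :=
    Real.exp_le_exp.2 (by exact_mod_cast Finset.card_image_le)
  have h2 : (Δg.card : ℝ) ≤ (rindCells x₀ m).card := by exact_mod_cast Finset.card_image_le
  gcongr

end Engine

end Summit.QuantumFields.YangMills.Cruxes.IR.AfPincerUc.Port

end
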